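import Mathlib
import Literature.NumberTheory.LFunctions.Zhang2022.Section12U030ResidueOne
import Literature.NumberTheory.LFunctions.Zhang2022.Section15CU055LData
import Literature.NumberTheory.LFunctions.Zhang2022.Section4GaussianWeight
import Literature.NumberTheory.LFunctions.Zhang2022.TypedSection12B
import HarnessLib

/-!
# Zhang (2022) §12 u030: the residue at the exceptional-zero pole against the model term
# `L′(1,χ)Π·β_aβ_b·x^{−s}/(−s)`

Topic `Literature/NumberTheory/LFunctions/Zhang2022` (Landau–Siegel audit tree; verdict-neutral).
Y. Zhang, *Discrete mean estimates and the Landau–Siegel zero*, arXiv:2211.02515v1 (2022)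
[Zhang2022LandauSiegel] — **an unrefereed manuscript under adjudication**; ZHANG-L lane WP12, helper
under the RT-02 node hTop25Ex (core `Typed.Sec12B.U030`, §12 p.70). Nothing here asserts or denies
Theorems 1–2 of the manuscript.

In the contour evaluation of the smoothed sum of Lemma 12.3's proof (tree:
`Lemma84.smoothedSeries_sub_residues_le`) the residue at the pole `u₁` coming from the exceptional zero
`ρ̃` of `L(s,χ)` is `r·K(τ)` with `r = 𝒰(ρ̃)L(ρ̃+β_a)L(ρ̃+β_b)/L′(ρ̃,χ)`, `K(τ) = x^τω₁(τ)/τ`,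
`τ = (ρ̃−1) − s`, `s = w − β₆`. THIS FILE compares it with the model `L′(1,χ)Π(d,r)β_aβ_b·x^{−s}/(−s)`
(the residue of the model integrand of u030/u031 at `s = β₆ − w`):

* `norm_coeff_sub_model_le` — the algebra: `‖uL_aL_b/L₀ − Πℓab‖ ≤ 8E_U|ℓ|K²α² + 6|Π|KαE +
  2|Π|K²α²E′ + 4|Π||ℓ|Kαδ` from `|L_a − ℓA|, |L_b − ℓB| ≤ E`, `|L₀ − ℓ| ≤ E′ ≤ ℓ₀/2`, `|u − Π| ≤ E_U`,
  `|A − a|, |B − b| ≤ δ`;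
* `norm_kernel_le`, `norm_kernel_sub_le` — `|K(τ)| ≤ 8e^π/α` and
  `|K(τ) − x^{−s}/(−s)| ≤ e^π((2e(1−ρ̃)log x + 1/(2Λ))·4/α + 8(1−ρ̃)/α²)`;
* `norm_resTwo_sub_model_le` — the instantiated comparison (Lemma 5.8 ×2, Lemma 8.3 (iii′) relative,
  `L′(ρ̃) − L′(1) = O(𝓛³(1−ρ̃))` by the tree's `CU055.norm_deriv_LFunction_sub_le`).

All `O(1−ρ̃)` and `O(Λ⁻¹)` pieces are negligible in the assembly (`1 − ρ̃ ≪ 𝓛⁻²⁰²²` under (A)).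

## References

* Y. Zhang, arXiv:2211.02515v1 (2022), §12 p.70 (proof of Lemma 12.3); §8 proof of Lemma 8.4 p.47.
  [cite: Zhang2022LandauSiegel, §12 p.70; §8 Lemma 8.4]
-/

noncomputable section

open Complex Real

namespace Literature.NumberTheory.LFunctions.Zhang2022.Lemma84

open Literature.NumberTheory.LFunctions.Zhang2022.Skeleton
open Literature.NumberTheory.LFunctions.Zhang2022.GaussWeight

section Algebra

/-- **The coefficient algebra for the second residue**: from `|L_a − ℓA|, |L_b − ℓB| ≤ E ≤ ℓ₀α/4`,
`|L₀ − ℓ| ≤ E′ ≤ ℓ₀/2`, `|u − Π| ≤ E_U`, `|A|, |B|, |a|, |b| ≤ Kα`, `|A − a|, |B − b| ≤ δ`,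
`0 < ℓ₀ ≤ |ℓ|`: `‖uL_aL_b/L₀ − Πℓab‖ ≤ 8E_U|ℓ|K²α² + 6|Π|KαE + 2|Π|K²α²E′ + 4|Π||ℓ|Kαδ`.
[cite: Zhang2022LandauSiegel, §8 Lemma 8.4 (proof, "By Lemma 5.8 and 8.3")] -/
theorem norm_coeff_sub_model_le {u La Lb L0 Pv ℓ A B a b : ℂ} {E EU E' α K ℓ₀ δ : ℝ}
    (hα : 0 < α) (hK : 1 ≤ K) (hℓ₀ : 0 < ℓ₀) (hℓ : ℓ₀ ≤ ‖ℓ‖) (hE0 : 0 ≤ E) (hEU0 : 0 ≤ EU)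
    (hE'0 : 0 ≤ E') (hδ0 : 0 ≤ δ) (hE : E ≤ ℓ₀ * α / 4) (hE' : E' ≤ ℓ₀ / 2)
    (ha : ‖La - ℓ * A‖ ≤ E) (hb : ‖Lb - ℓ * B‖ ≤ E) (h0 : ‖L0 - ℓ‖ ≤ E') (hu : ‖u - Pv‖ ≤ EU)
    (hA : ‖A‖ ≤ K * α) (hB : ‖B‖ ≤ K * α) (ha' : ‖a‖ ≤ K * α) (hb' : ‖b‖ ≤ K * α)
    (hAa : ‖A - a‖ ≤ δ) (hBb : ‖B - b‖ ≤ δ) :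
    ‖u * La * Lb / L0 - Pv * ℓ * a * b‖ ≤
      8 * EU * ‖ℓ‖ * K ^ 2 * α ^ 2 + 6 * ‖Pv‖ * K * α * E + 2 * ‖Pv‖ * K ^ 2 * α ^ 2 * E' +
        4 * ‖Pv‖ * ‖ℓ‖ * K * α * δ := by
  have hℓpos : 0 < ‖ℓ‖ := lt_of_lt_of_le hℓ₀ hℓ
  -- `‖L₀‖ ≥ ‖ℓ‖/2`
  have hL0 : ‖ℓ‖ / 2 ≤ ‖L0‖ := by
    have h1 := norm_sub_norm_le ℓ L0
    rw [norm_sub_rev] at h1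
    linarith
  have hL0pos : 0 < ‖L0‖ := by linarith
  have hL0ne : L0 ≠ 0 := norm_pos_iff.mp hL0pos
  -- sizes of `L_a, L_b`
  have hEℓ : E ≤ ‖ℓ‖ * K * α := by
    calc E ≤ ℓ₀ * α / 4 := hE
      _ ≤ ‖ℓ‖ * α / 4 := by gcongr
      _ ≤ ‖ℓ‖ * K * α := by nlinarith [mul_pos hℓpos hα]
  have hLa : ‖La‖ ≤ 2 * ‖ℓ‖ * K * α := by
    calc ‖La‖ = ‖(La - ℓ * A) + ℓ * A‖ := by rw [sub_add_cancel]
      _ ≤ ‖La - ℓ * A‖ + ‖ℓ * A‖ := norm_add_le _ _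
      _ ≤ E + ‖ℓ‖ * (K * α) := by rw [norm_mul]; gcongr
      _ ≤ 2 * ‖ℓ‖ * K * α := by linarith
  have hLb : ‖Lb‖ ≤ 2 * ‖ℓ‖ * K * α := by
    calc ‖Lb‖ = ‖(Lb - ℓ * B) + ℓ * B‖ := by rw [sub_add_cancel]
      _ ≤ ‖Lb - ℓ * B‖ + ‖ℓ * B‖ := norm_add_le _ _
      _ ≤ E + ‖ℓ‖ * (K * α) := by rw [norm_mul]; gcongr
      _ ≤ 2 * ‖ℓ‖ * K * α := by linarith
  -- the numerator
  set N : ℂ := u * La * Lb - Pv * ℓ * a * b * L0 with hN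
  have hNeq : N = (u - Pv) * La * Lb + Pv * ((La - ℓ * A) * Lb + ℓ * A * (Lb - ℓ * B)) +
      Pv * ℓ ^ 2 * ((A - a) * B + a * (B - b)) + Pv * ℓ * a * b * (ℓ - L0) := by
    rw [hN]; ring
  have hquot : u * La * Lb / L0 - Pv * ℓ * a * b = N / L0 := by
    rw [hN]; field_simp
  have hNle : ‖N‖ ≤ EU * (2 * ‖ℓ‖ * K * α) * (2 * ‖ℓ‖ * K * α) +
      ‖Pv‖ * (E * (2 * ‖ℓ‖ * K * α) + ‖ℓ‖ * (K * α) * E) +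
      ‖Pv‖ * ‖ℓ‖ ^ 2 * (δ * (K * α) + K * α * δ) + ‖Pv‖ * ‖ℓ‖ * (K * α) * (K * α) * E' := by
    rw [hNeq]
    have h1 : ‖(u - Pv) * La * Lb‖ ≤ EU * (2 * ‖ℓ‖ * K * α) * (2 * ‖ℓ‖ * K * α) := by
      rw [norm_mul, norm_mul]; gcongr
    have h2 : ‖Pv * ((La - ℓ * A) * Lb + ℓ * A * (Lb - ℓ * B))‖ ≤
        ‖Pv‖ * (E * (2 * ‖ℓ‖ * K * α) + ‖ℓ‖ * (K * α) * E) := by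
      rw [norm_mul]
      gcongr
      calc ‖(La - ℓ * A) * Lb + ℓ * A * (Lb - ℓ * B)‖
          ≤ ‖(La - ℓ * A) * Lb‖ + ‖ℓ * A * (Lb - ℓ * B)‖ := norm_add_le _ _
        _ ≤ E * (2 * ‖ℓ‖ * K * α) + ‖ℓ‖ * (K * α) * E := by
            rw [norm_mul, norm_mul, norm_mul]; gcongr
    have h3 : ‖Pv * ℓ ^ 2 * ((A - a) * B + a * (B - b))‖ ≤
        ‖Pv‖ * ‖ℓ‖ ^ 2 * (δ * (K * α) + K * α * δ) := by
      rw [norm_mul, norm_mul, norm_pow]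
      gcongr
      calc ‖(A - a) * B + a * (B - b)‖ ≤ ‖(A - a) * B‖ + ‖a * (B - b)‖ := norm_add_le _ _
        _ ≤ δ * (K * α) + K * α * δ := by rw [norm_mul, norm_mul]; gcongr
    have h4 : ‖Pv * ℓ * a * b * (ℓ - L0)‖ ≤ ‖Pv‖ * ‖ℓ‖ * (K * α) * (K * α) * E' := by
      rw [norm_mul, norm_mul, norm_mul, norm_mul, norm_sub_rev]
      gcongr
    calc _ ≤ ‖(u - Pv) * La * Lb + Pv * ((La - ℓ * A) * Lb + ℓ * A * (Lb - ℓ * B)) +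
          Pv * ℓ ^ 2 * ((A - a) * B + a * (B - b))‖ + ‖Pv * ℓ * a * b * (ℓ - L0)‖ := norm_add_le _ _
      _ ≤ (‖(u - Pv) * La * Lb + Pv * ((La - ℓ * A) * Lb + ℓ * A * (Lb - ℓ * B))‖ +
          ‖Pv * ℓ ^ 2 * ((A - a) * B + a * (B - b))‖) + ‖Pv * ℓ * a * b * (ℓ - L0)‖ := by
          gcongr; exact norm_add_le _ _
      _ ≤ ((‖(u - Pv) * La * Lb‖ + ‖Pv * ((La - ℓ * A) * Lb + ℓ * A * (Lb - ℓ * B))‖) +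
          ‖Pv * ℓ ^ 2 * ((A - a) * B + a * (B - b))‖) + ‖Pv * ℓ * a * b * (ℓ - L0)‖ := by
          gcongr; exact norm_add_le _ _
      _ ≤ _ := by linarith
  rw [hquot, norm_div]
  rw [div_le_iff₀ hL0pos]
  have hPv := norm_nonneg Pv
  -- `‖N‖ ≤ RHS · ‖ℓ‖/2 ≤ RHS · ‖L₀‖`
  have hR0 : 0 ≤ 8 * EU * ‖ℓ‖ * K ^ 2 * α ^ 2 + 6 * ‖Pv‖ * K * α * E + 2 * ‖Pv‖ * K ^ 2 * α ^ 2 * E' +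
      4 * ‖Pv‖ * ‖ℓ‖ * K * α * δ := by positivity
  calc ‖N‖ ≤ (8 * EU * ‖ℓ‖ * K ^ 2 * α ^ 2 + 6 * ‖Pv‖ * K * α * E + 2 * ‖Pv‖ * K ^ 2 * α ^ 2 * E' +
        4 * ‖Pv‖ * ‖ℓ‖ * K * α * δ) * (‖ℓ‖ / 2) := by
        refine hNle.trans (le_of_eq ?_); ring
    _ ≤ _ := by gcongr

/-- **Size of the kernel at the second pole**: for `τ = κ − s` with `−α/4 ≤ κ ≤ 0`, `α/2 ≤ |s|`,
`|s| ≤ 1/2`, `Re s ≥ −α`, `1 ≤ Y`, `α·log Y ≤ π`, `1 ≤ Λ`: `‖Y^τω₁(τ)/τ‖ ≤ 8e^π/α`.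
[cite: Zhang2022LandauSiegel, §12 p.70 (proof of Lemma 12.3)] -/
theorem norm_kernel_le {Y Λ α κ : ℝ} {s : ℂ} (hα : 0 < α) (hκ0 : κ ≤ 0) (hκ : -(α / 4) ≤ κ)
    (hs : α / 2 ≤ ‖s‖) (hs1 : ‖s‖ ≤ 1 / 2) (hsre : -α ≤ s.re) (hY : 1 ≤ Y) (hαY : α * Real.log Y ≤ π)
    (hΛ : 1 ≤ Λ) :
    ‖(Y : ℂ) ^ ((κ : ℂ) - s) * omega1 Λ ((κ : ℂ) - s) / ((κ : ℂ) - s)‖ ≤ 8 * Real.exp π / α := by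
  have hY0 : 0 < Y := by linarith
  set τ : ℂ := (κ : ℂ) - s with hτ
  have hτre : τ.re = κ - s.re := by simp [hτ]
  have hτn : α / 4 ≤ ‖τ‖ := by
    have h1 : ‖s‖ - ‖(κ : ℂ)‖ ≤ ‖(κ : ℂ) - s‖ := by
      rw [norm_sub_rev]; exact norm_sub_norm_le _ _
    have h2 : ‖(κ : ℂ)‖ ≤ α / 4 := by
      rw [Complex.norm_real, Real.norm_eq_abs, abs_of_nonpos hκ0]; linarith
    rw [hτ]; linarith
  have hτpos : 0 < ‖τ‖ := lt_of_lt_of_le (by positivity) hτn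
  have hτ1 : ‖τ‖ ≤ 1 := by
    calc ‖τ‖ ≤ ‖(κ : ℂ)‖ + ‖s‖ := norm_sub_le _ _
      _ ≤ α / 4 + 1 / 2 := by
          rw [Complex.norm_real, Real.norm_eq_abs, abs_of_nonpos hκ0]
          linarith
      _ ≤ 1 := by
          have : α ≤ 1 := by linarith
          linarith
  -- `‖Y^τ‖ = Y^{Re τ} ≤ Y^α ≤ e^π`
  have hYτ : ‖(Y : ℂ) ^ τ‖ ≤ Real.exp π := by
    rw [Complex.norm_cpow_eq_rpow_re_of_pos hY0, hτre]
    calc Y ^ (κ - s.re) ≤ Y ^ α := Real.rpow_le_rpow_of_exponent_le hY (by linarith)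
      _ = Real.exp (α * Real.log Y) := by rw [Real.rpow_def_of_pos hY0, mul_comm]
      _ ≤ Real.exp π := Real.exp_le_exp.mpr hαY
  -- `‖ω₁(τ)‖ ≤ e^{1/4} ≤ 2`
  have hω : ‖omega1 Λ τ‖ ≤ 2 := by
    rw [omega1, Complex.norm_exp]
    have hre : (τ ^ 2 / ((4 * Λ : ℝ) : ℂ)).re ≤ 1 / 4 := by
      have h1 : (τ ^ 2 / ((4 * Λ : ℝ) : ℂ)).re ≤ ‖τ ^ 2 / ((4 * Λ : ℝ) : ℂ)‖ := Complex.re_le_norm _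
      have h2 : ‖τ ^ 2 / ((4 * Λ : ℝ) : ℂ)‖ ≤ 1 / 4 := by
        rw [norm_div, norm_pow, Complex.norm_real, Real.norm_eq_abs, abs_of_pos (by positivity)]
        rw [div_le_iff₀ (by positivity)]
        nlinarith [norm_nonneg τ]
      linarith
    calc Real.exp (τ ^ 2 / ((4 * Λ : ℝ) : ℂ)).re ≤ Real.exp (1 / 4) := Real.exp_le_exp.mpr hre
      _ ≤ 2 := by
          have h3 : Real.exp (1 / 4 : ℝ) ≤ Real.exp (1 / 2) := Real.exp_le_exp.mpr (by norm_num)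
          have h4 : Real.exp (1 / 2 : ℝ) ^ 2 = Real.exp 1 := by rw [← Real.exp_nat_mul]; norm_num
          nlinarith [Real.exp_one_lt_d9, Real.exp_pos (1 / 2 : ℝ)]
  rw [norm_div, norm_mul, div_le_div_iff₀ hτpos hα]
  calc ‖(Y : ℂ) ^ τ‖ * ‖omega1 Λ τ‖ * α ≤ Real.exp π * 2 * α := by gcongr
    _ = 8 * Real.exp π * (α / 4) := by ring
    _ ≤ 8 * Real.exp π * ‖τ‖ := by gcongr

/-- **The kernel at the second pole against `Y^{−s}/(−s)`**: with `τ = κ − s` as in `norm_kernel_le`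
and moreover `|κ|·log Y ≤ 1`:
`‖Y^τω₁(τ)/τ − Y^{−s}/(−s)‖ ≤ e^π((2e|κ|log Y + 1/(2Λ))·(4/α) + |κ|·8/α²)`
(`Y^τ = Y^κY^{−s}`, `|Y^κ − 1| ≤ e|κ|log Y`, `|ω₁(τ) − 1| ≤ |τ|²/(2Λ)`).
[cite: Zhang2022LandauSiegel, §12 p.70 (proof of Lemma 12.3)] -/
theorem norm_kernel_sub_le {Y Λ α κ : ℝ} {s : ℂ} (hα : 0 < α) (hκ0 : κ ≤ 0) (hκ : -(α / 4) ≤ κ)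
    (hs : α / 2 ≤ ‖s‖) (hs1 : ‖s‖ ≤ 1 / 2) (hsre : -α ≤ s.re) (hY : 1 ≤ Y) (hαY : α * Real.log Y ≤ π)
    (hκY : |κ| * Real.log Y ≤ 1) (hΛ : 1 ≤ Λ) :
    ‖(Y : ℂ) ^ ((κ : ℂ) - s) * omega1 Λ ((κ : ℂ) - s) / ((κ : ℂ) - s) -
        (Y : ℂ) ^ (-s) / (-s)‖ ≤
      Real.exp π * ((2 * Real.exp 1 * |κ| * Real.log Y + 1 / (2 * Λ)) * (4 / α) +
        |κ| * (8 / α ^ 2)) := by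
  have hY0 : 0 < Y := by linarith
  have hYc : (Y : ℂ) ≠ 0 := by exact_mod_cast hY0.ne'
  set τ : ℂ := (κ : ℂ) - s with hτ
  have hτn : α / 4 ≤ ‖τ‖ := by
    have h1 : ‖s‖ - ‖(κ : ℂ)‖ ≤ ‖(κ : ℂ) - s‖ := by
      rw [norm_sub_rev]; exact norm_sub_norm_le _ _
    have h2 : ‖(κ : ℂ)‖ ≤ α / 4 := by
      rw [Complex.norm_real, Real.norm_eq_abs, abs_of_nonpos hκ0]; linarith
    rw [hτ]; linarith
  have hτpos : 0 < ‖τ‖ := lt_of_lt_of_le (by positivity) hτn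
  have hτne : τ ≠ 0 := norm_pos_iff.mp hτpos
  have hspos : 0 < ‖s‖ := lt_of_lt_of_le (by positivity) hs
  have hsne : s ≠ 0 := norm_pos_iff.mp hspos
  have hτ1 : ‖τ‖ ≤ 1 := by
    calc ‖τ‖ ≤ ‖(κ : ℂ)‖ + ‖s‖ := norm_sub_le _ _
      _ ≤ α / 4 + 1 / 2 := by
          rw [Complex.norm_real, Real.norm_eq_abs, abs_of_nonpos hκ0]; linarith
      _ ≤ 1 := by
          have : α ≤ 1 := by linarith
          linarith
  -- `Y^τ = Y^κ · Y^{−s}`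
  set q : ℂ := (Y : ℂ) ^ (κ : ℂ) * omega1 Λ τ with hq
  have hsplit : (Y : ℂ) ^ τ = (Y : ℂ) ^ (κ : ℂ) * (Y : ℂ) ^ (-s) := by
    rw [hτ, sub_eq_add_neg, Complex.cpow_add _ _ hYc]
  have hYs : ‖(Y : ℂ) ^ (-s)‖ ≤ Real.exp π := by
    rw [Complex.norm_cpow_eq_rpow_re_of_pos hY0, Complex.neg_re]
    calc Y ^ (-s.re) ≤ Y ^ α := Real.rpow_le_rpow_of_exponent_le hY (by linarith)
      _ = Real.exp (α * Real.log Y) := by rw [Real.rpow_def_of_pos hY0, mul_comm]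
      _ ≤ Real.exp π := Real.exp_le_exp.mpr hαY
  -- the identity `K(τ) − Y^{−s}/(−s) = Y^{−s}((q − 1)s + κ)/(τ s)`
  have hid : (Y : ℂ) ^ τ * omega1 Λ τ / τ - (Y : ℂ) ^ (-s) / (-s) =
      (Y : ℂ) ^ (-s) * (((q - 1) * s + κ) / (τ * s)) := by
    rw [hsplit, hq]
    have : τ = (κ : ℂ) - s := hτ
    rw [this] at hτne ⊢
    field_simp
    ring
  -- `‖q − 1‖ ≤ 2e|κ|log Y + 1/(2Λ)`
  have hYκ : ‖(Y : ℂ) ^ (κ : ℂ) - 1‖ ≤ Real.exp 1 * |κ| * Real.log Y := by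
    have h1 : (Y : ℂ) ^ (κ : ℂ) = ((Y ^ κ : ℝ) : ℂ) := by
      rw [Complex.ofReal_cpow hY0.le]
    rw [h1, ← Complex.ofReal_one, ← Complex.ofReal_sub, Complex.norm_real, Real.norm_eq_abs,
      Real.rpow_def_of_pos hY0]
    have hx : |Real.log Y * κ| ≤ 1 := by rw [abs_mul, abs_of_nonneg (Real.log_nonneg hY), mul_comm]; exact hκY
    have h2 := Real.abs_exp_sub_one_le (x := Real.log Y * κ) hx
    have hnn : 0 ≤ |κ| * Real.log Y := mul_nonneg (abs_nonneg κ) (Real.log_nonneg hY)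
    have h2e : (2 : ℝ) ≤ Real.exp 1 := by have := Real.add_one_le_exp (1 : ℝ); linarith
    calc |Real.exp (Real.log Y * κ) - 1| ≤ 2 * |Real.log Y * κ| := h2
      _ = 2 * (|κ| * Real.log Y) := by rw [abs_mul, abs_of_nonneg (Real.log_nonneg hY)]; ring
      _ ≤ Real.exp 1 * (|κ| * Real.log Y) := mul_le_mul_of_nonneg_right h2e hnn
      _ = Real.exp 1 * |κ| * Real.log Y := by ring
  have hωn : ‖omega1 Λ τ‖ ≤ 2 := by
    rw [omega1, Complex.norm_exp]
    have hre : (τ ^ 2 / ((4 * Λ : ℝ) : ℂ)).re ≤ 1 / 4 := by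
      have h1 : (τ ^ 2 / ((4 * Λ : ℝ) : ℂ)).re ≤ ‖τ ^ 2 / ((4 * Λ : ℝ) : ℂ)‖ := Complex.re_le_norm _
      have h2 : ‖τ ^ 2 / ((4 * Λ : ℝ) : ℂ)‖ ≤ 1 / 4 := by
        rw [norm_div, norm_pow, Complex.norm_real, Real.norm_eq_abs, abs_of_pos (by positivity)]
        rw [div_le_iff₀ (by positivity)]
        nlinarith [norm_nonneg τ]
      linarith
    calc Real.exp (τ ^ 2 / ((4 * Λ : ℝ) : ℂ)).re ≤ Real.exp (1 / 4) := Real.exp_le_exp.mpr hre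
      _ ≤ 2 := by
          have h3 : Real.exp (1 / 4 : ℝ) ≤ Real.exp (1 / 2) := Real.exp_le_exp.mpr (by norm_num)
          have h4 : Real.exp (1 / 2 : ℝ) ^ 2 = Real.exp 1 := by rw [← Real.exp_nat_mul]; norm_num
          nlinarith [Real.exp_one_lt_d9, Real.exp_pos (1 / 2 : ℝ)]
  have hω1 : ‖omega1 Λ τ - 1‖ ≤ 1 / (2 * Λ) := by
    rw [omega1]
    have hz : ‖τ ^ 2 / ((4 * Λ : ℝ) : ℂ)‖ ≤ 1 / (4 * Λ) := by
      rw [norm_div, norm_pow, Complex.norm_real, Real.norm_eq_abs, abs_of_pos (by positivity)]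
      rw [div_le_div_iff₀ (by positivity) (by positivity)]
      nlinarith [norm_nonneg τ, (pow_le_one₀ (norm_nonneg τ) hτ1 : ‖τ‖ ^ 2 ≤ 1)]
    have hz1 : ‖τ ^ 2 / ((4 * Λ : ℝ) : ℂ)‖ ≤ 1 := hz.trans (by
      rw [div_le_one (by positivity)]; linarith)
    calc ‖cexp (τ ^ 2 / ((4 * Λ : ℝ) : ℂ)) - 1‖ ≤ 2 * ‖τ ^ 2 / ((4 * Λ : ℝ) : ℂ)‖ :=
          Complex.norm_exp_sub_one_le hz1
      _ ≤ 2 * (1 / (4 * Λ)) := by gcongr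
      _ = 1 / (2 * Λ) := by ring
  have hq1 : ‖q - 1‖ ≤ 2 * Real.exp 1 * |κ| * Real.log Y + 1 / (2 * Λ) := by
    have e : q - 1 = ((Y : ℂ) ^ (κ : ℂ) - 1) * omega1 Λ τ + (omega1 Λ τ - 1) := by rw [hq]; ring
    rw [e]
    have hnn : 0 ≤ Real.exp 1 * |κ| * Real.log Y :=
      mul_nonneg (mul_nonneg (Real.exp_pos 1).le (abs_nonneg κ)) (Real.log_nonneg hY)
    calc ‖((Y : ℂ) ^ (κ : ℂ) - 1) * omega1 Λ τ + (omega1 Λ τ - 1)‖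
        ≤ ‖((Y : ℂ) ^ (κ : ℂ) - 1) * omega1 Λ τ‖ + ‖omega1 Λ τ - 1‖ := norm_add_le _ _
      _ ≤ (Real.exp 1 * |κ| * Real.log Y) * 2 + 1 / (2 * Λ) := by
          rw [norm_mul]
          exact add_le_add (mul_le_mul hYκ hωn (norm_nonneg _) hnn) hω1
      _ = _ := by ring
  -- assemble
  rw [hid, norm_mul, norm_div, norm_mul]
  have hκn : ‖(κ : ℂ)‖ = |κ| := by rw [Complex.norm_real, Real.norm_eq_abs]
  have hnum : ‖(q - 1) * s + κ‖ ≤ (2 * Real.exp 1 * |κ| * Real.log Y + 1 / (2 * Λ)) * ‖s‖ + |κ| := by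
    calc ‖(q - 1) * s + κ‖ ≤ ‖(q - 1) * s‖ + ‖(κ : ℂ)‖ := norm_add_le _ _
      _ ≤ (2 * Real.exp 1 * |κ| * Real.log Y + 1 / (2 * Λ)) * ‖s‖ + |κ| := by
          rw [norm_mul, hκn]; gcongr
  have hden : α / 4 * ‖s‖ ≤ ‖τ‖ * ‖s‖ := by gcongr
  have hdenpos : 0 < ‖τ‖ * ‖s‖ := by positivity
  calc ‖(Y : ℂ) ^ (-s)‖ * (‖(q - 1) * s + ↑κ‖ / (‖τ‖ * ‖s‖))
      ≤ Real.exp π * (((2 * Real.exp 1 * |κ| * Real.log Y + 1 / (2 * Λ)) * ‖s‖ + |κ|) /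
          (‖τ‖ * ‖s‖)) := by gcongr
    _ = Real.exp π * ((2 * Real.exp 1 * |κ| * Real.log Y + 1 / (2 * Λ)) / ‖τ‖ +
          |κ| / (‖τ‖ * ‖s‖)) := by
        congr 1
        field_simp
    _ ≤ Real.exp π * ((2 * Real.exp 1 * |κ| * Real.log Y + 1 / (2 * Λ)) * (4 / α) +
          |κ| * (8 / α ^ 2)) := by
        have hX0 : 0 ≤ 2 * Real.exp 1 * |κ| * Real.log Y + 1 / (2 * Λ) := by
          have h1 : 0 ≤ |κ| * Real.log Y := mul_nonneg (abs_nonneg κ) (Real.log_nonneg hY)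
          have h2 : 0 ≤ 1 / (2 * Λ) := by positivity
          have h3 : 0 ≤ 2 * Real.exp 1 * |κ| * Real.log Y := by
            have := (Real.exp_pos 1).le; nlinarith
          linarith
        have h4τ : 1 / ‖τ‖ ≤ 4 / α := by rw [div_le_div_iff₀ hτpos hα]; linarith
        have h8 : 1 / (‖τ‖ * ‖s‖) ≤ 8 / α ^ 2 := by
          rw [div_le_div_iff₀ hdenpos (by positivity)]
          nlinarith [mul_le_mul hτn hs (by positivity) (norm_nonneg _)]
        have ha : (2 * Real.exp 1 * |κ| * Real.log Y + 1 / (2 * Λ)) / ‖τ‖ ≤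
            (2 * Real.exp 1 * |κ| * Real.log Y + 1 / (2 * Λ)) * (4 / α) := by
          rw [div_eq_mul_one_div]; exact mul_le_mul_of_nonneg_left h4τ hX0
        have hb : |κ| / (‖τ‖ * ‖s‖) ≤ |κ| * (8 / α ^ 2) := by
          rw [div_eq_mul_one_div]; exact mul_le_mul_of_nonneg_left h8 (abs_nonneg κ)
        exact mul_le_mul_of_nonneg_left (add_le_add ha hb) (Real.exp_pos π).le

end Algebra

section ResidueTwo

variable {D : ℕ} [NeZero D] (χ : DirichletCharacter ℂ D) (c' : ℝ)

set_option maxHeartbeats 1000000 in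
/-- **The residue at the exceptional-zero pole against the model.** With the hypotheses of
`Lemma84.norm_resOne_sub_model_le` ((A), `K ≥ 7+15|c′|`, `Kπ ≤ 𝓛⁸`, `0 < ℓ₀ ≤ |L′(1,χ)|`,
`E ≤ ℓ₀α/4`, Lemma 8.3 (iii′) relative) and, for the exceptional zero `ρ̃ ≤ 1`:
`1 − ρ̃ ≤ α/4`, `1 − ρ̃ ≤ 1/(4𝓛)`, `8e^{9/2}(1+𝓛)𝓛²(1−ρ̃) ≤ ℓ₀/2`, and for the cut-off point
`1 ≤ Y`, `α log Y ≤ π`, `(1−ρ̃)log Y ≤ 1`, `Λ ≥ 1`, `|w| = α`: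
`‖r·K(τ) − L′(1,χ)Π(d,r)β_aβ_b·Y^{−s}/(−s)‖ ≤ (8e^π/α)(8E_Uℓ₁K²α² + 6Π̂²KαE + 2Π̂²K²α²E′ +
4Π̂²ℓ₁Kα(1−ρ̃)) + Π̂²ℓ₁K²α²·e^π((2e(1−ρ̃)log Y + 1/(2Λ))(4/α) + (1−ρ̃)·8/α²)`
(`r = 𝒰(ρ̃)L(ρ̃+β_a)L(ρ̃+β_b)/L′(ρ̃)`, `τ = (ρ̃−1) − s`, `s = w − β₆`, `ℓ₁ = 2e^{9/2}(1+𝓛)𝓛`,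
`E_U = C₈₃𝓛⁻⁸Π̂`, `E′ = 8e^{9/2}(1+𝓛)𝓛²(1−ρ̃)`).
[cite: Zhang2022LandauSiegel, §12 p.70 (proof of Lemma 12.3); §8 Lemma 8.4 (proof)] -/
theorem norm_resTwo_sub_model_le (hprim : χ.IsPrimitive) (h𝓛 : 3 ≤ Real.log D)
    (hA : ‖χ.LFunction 1‖ ≤ 1 / Real.log D ^ 2022) (j : ℕ) {d r : ℕ} (hd : d ≠ 0) (hr : r ≠ 0)
    (U : ℂ → ℂ) {C₈₃ K ℓ₀ : ℝ} (hC₈₃ : 0 ≤ C₈₃) (hK : 7 + 15 * |c'| ≤ K)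
    (hKL : K * π ≤ Real.log D ^ 8) (hℓ₀ : 0 < ℓ₀) (hℓ : ℓ₀ ≤ ‖deriv χ.LFunction 1‖)
    (hE : (1 + 16 * Real.exp (9 / 2) * π ^ 2 * K ^ 2) / Real.log D ^ 15 ≤ ℓ₀ * alpha D / 4)
    (hU3 : ∀ s : ℂ, ‖s - 1‖ ≤ 5 * alpha D → ‖U s - PiW χ d r‖ ≤
      C₈₃ * (ell D ^ 8)⁻¹ * ∏ q ∈ (d * r).primeFactors, (1 - (q : ℝ)⁻¹)⁻¹)
    {ρ : ℝ} (hρ1 : ρ ≤ 1) (hρα : 1 - ρ ≤ alpha D / 4) (hρL : 1 - ρ ≤ 1 / (4 * Real.log D))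
    (hρE : 8 * Real.exp (9 / 2) * (1 + Real.log D) * Real.log D ^ 2 * (1 - ρ) ≤ ℓ₀ / 2)
    {Y Λ : ℝ} (hY : 1 ≤ Y) (hαY : alpha D * Real.log Y ≤ π) (hρY : (1 - ρ) * Real.log Y ≤ 1)
    (hΛ : 1 ≤ Λ) {w : ℂ} (hw : ‖w‖ = alpha D) :
    ‖U ρ * χ.LFunction (ρ + betaJ c' D (j + 1)) * χ.LFunction (ρ + betaJ c' D (j + 2)) /
          deriv χ.LFunction ρ *
          ((Y : ℂ) ^ (((ρ - 1 : ℝ) : ℂ) - (w - beta6 D)) *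
            omega1 Λ (((ρ - 1 : ℝ) : ℂ) - (w - beta6 D)) / (((ρ - 1 : ℝ) : ℂ) - (w - beta6 D))) -
        deriv χ.LFunction 1 * PiW χ d r *
          (betaJ c' D (j + 1) * betaJ c' D (j + 2) *
            ((Y : ℂ) ^ (-(w - beta6 D)) / (-(w - beta6 D))))‖ ≤
      8 * Real.exp π / alpha D *
          (8 * (C₈₃ * (ell D ^ 8)⁻¹ * ∏ q ∈ (d * r).primeFactors, (1 - (q : ℝ)⁻¹)⁻¹) *
              (2 * Real.exp (9 / 2) * (1 + Real.log D) * Real.log D) * K ^ 2 * alpha D ^ 2 +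
            6 * (∏ q ∈ (d * r).primeFactors, (1 - (q : ℝ)⁻¹)⁻¹) ^ 2 * K * alpha D *
              ((1 + 16 * Real.exp (9 / 2) * π ^ 2 * K ^ 2) / Real.log D ^ 15) +
            2 * (∏ q ∈ (d * r).primeFactors, (1 - (q : ℝ)⁻¹)⁻¹) ^ 2 * K ^ 2 * alpha D ^ 2 *
              (8 * Real.exp (9 / 2) * (1 + Real.log D) * Real.log D ^ 2 * (1 - ρ)) +
            4 * (∏ q ∈ (d * r).primeFactors, (1 - (q : ℝ)⁻¹)⁻¹) ^ 2 *
              (2 * Real.exp (9 / 2) * (1 + Real.log D) * Real.log D) * K * alpha D * (1 - ρ)) +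
        (∏ q ∈ (d * r).primeFactors, (1 - (q : ℝ)⁻¹)⁻¹) ^ 2 *
            (2 * Real.exp (9 / 2) * (1 + Real.log D) * Real.log D) * K ^ 2 * alpha D ^ 2 *
          (Real.exp π * ((2 * Real.exp 1 * |ρ - 1| * Real.log Y + 1 / (2 * Λ)) * (4 / alpha D) +
            |ρ - 1| * (8 / alpha D ^ 2))) := by
  set 𝓛 : ℝ := Real.log D with h𝓛def
  set α : ℝ := alpha D with hαdef
  set βa : ℂ := betaJ c' D (j + 1) with hβadef
  set βb : ℂ := betaJ c' D (j + 2) with hβbdef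
  set hatPi : ℝ := ∏ q ∈ (d * r).primeFactors, (1 - (q : ℝ)⁻¹)⁻¹ with hhatPi
  set E : ℝ := (1 + 16 * Real.exp (9 / 2) * π ^ 2 * K ^ 2) / 𝓛 ^ 15 with hEdef
  set E' : ℝ := 8 * Real.exp (9 / 2) * (1 + 𝓛) * 𝓛 ^ 2 * (1 - ρ) with hE'def
  set ℓ : ℂ := deriv χ.LFunction 1 with hℓdef
  set ℓ₁ : ℝ := 2 * Real.exp (9 / 2) * (1 + 𝓛) * 𝓛 with hℓ₁def
  have hℓ2 : 2 ≤ ell D := by rw [ell]; linarith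
  have h𝓛0 : 0 < 𝓛 := by linarith
  have hα0 : 0 < α := alpha_pos' (by linarith)
  have hαeq : α = π / 𝓛 ^ 9 := alpha_eq D
  have hαℓ : α * ell D ≤ 1 := alpha_mul_ell_le_one hℓ2
  have hα5 : α ≤ 1 / 5 := by
    rw [hαeq, div_le_iff₀ (by positivity)]
    have h9 : (3 : ℝ) ^ 9 ≤ 𝓛 ^ 9 := pow_le_pow_left₀ (by norm_num) h𝓛 9
    nlinarith [Real.pi_le_four]
  have hK1 : 1 ≤ K := by linarith [abs_nonneg c']
  have hκ0 : ρ - 1 ≤ 0 := by linarith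
  have hκ : -(α / 4) ≤ ρ - 1 := by rw [hαdef]; linarith
  have habsκ : |ρ - 1| = 1 - ρ := by rw [abs_of_nonpos hκ0]; ring
  -- the variable `s = w − β₆`
  set s : ℂ := w - beta6 D with hsdef
  obtain ⟨hs_lo, hs_hi⟩ := norm_w_sub_beta6_bounds h𝓛 hw
  rw [← hsdef, ← hαdef] at hs_lo hs_hi
  have hs1 : ‖s‖ ≤ 1 / 2 := by linarith
  have hsre : -α ≤ s.re := by
    have h1 : s.re = w.re := by simp [hsdef, beta6]
    rw [h1]
    have h2 : |w.re| ≤ ‖w‖ := Complex.abs_re_le_norm w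
    rw [hw] at h2
    linarith [neg_abs_le w.re]
  -- sizes of the shifts
  have hβ : ∀ i : ℕ, ‖betaJ c' D i‖ ≤ 3 * α * (1 + 5 * |c'|) := by
    intro i
    have h := norm_betaJ_le c' D i hα0.le (by linarith : 0 ≤ ell D)
    refine h.trans ?_
    have : 5 * |c'| * alpha D * ell D ≤ 5 * |c'| := by
      calc 5 * |c'| * alpha D * ell D = 5 * |c'| * (alpha D * ell D) := by ring
        _ ≤ 5 * |c'| * 1 := by gcongr
        _ = 5 * |c'| := mul_one _
    rw [← hαdef] at this ⊢
    nlinarith [abs_nonneg c']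
  have haK : ‖βa‖ ≤ K * α := by
    calc ‖βa‖ ≤ 3 * α * (1 + 5 * |c'|) := hβ _
      _ ≤ K * α := by nlinarith [abs_nonneg c']
  have hbK : ‖βb‖ ≤ K * α := by
    calc ‖βb‖ ≤ 3 * α * (1 + 5 * |c'|) := hβ _
      _ ≤ K * α := by nlinarith [abs_nonneg c']
  -- `A = (ρ̃ − 1) + β_a`, `B = (ρ̃ − 1) + β_b`
  set A : ℂ := ((ρ - 1 : ℝ) : ℂ) + βa with hAdef
  set B : ℂ := ((ρ - 1 : ℝ) : ℂ) + βb with hBdef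
  have hκn : ‖((ρ - 1 : ℝ) : ℂ)‖ = 1 - ρ := by
    rw [Complex.norm_real, Real.norm_eq_abs, habsκ]
  have hAK : ‖A‖ ≤ K * α := by
    calc ‖A‖ ≤ ‖((ρ - 1 : ℝ) : ℂ)‖ + ‖βa‖ := norm_add_le _ _
      _ ≤ α / 4 + 3 * α * (1 + 5 * |c'|) := by rw [hκn]; exact add_le_add (by linarith) (hβ _)
      _ ≤ K * α := by nlinarith [abs_nonneg c']
  have hBK : ‖B‖ ≤ K * α := by
    calc ‖B‖ ≤ ‖((ρ - 1 : ℝ) : ℂ)‖ + ‖βb‖ := norm_add_le _ _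
      _ ≤ α / 4 + 3 * α * (1 + 5 * |c'|) := by rw [hκn]; exact add_le_add (by linarith) (hβ _)
      _ ≤ K * α := by nlinarith [abs_nonneg c']
  have hAa : ‖A - βa‖ ≤ 1 - ρ := by rw [hAdef, add_sub_cancel_right, hκn]
  have hBb : ‖B - βb‖ ≤ 1 - ρ := by rw [hBdef, add_sub_cancel_right, hκn]
  -- Lemma 5.8 at `1 + A`, `1 + B`
  have h58 : ∀ z : ℂ, ‖z‖ ≤ K * α → ‖χ.LFunction (1 + z) - ℓ * z‖ ≤ E := by
    intro z hz
    have hz' : ‖(1 + z) - 1‖ ≤ K * π / Real.log D ^ 9 := by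
      rw [add_sub_cancel_left, ← h𝓛def]
      calc ‖z‖ ≤ K * α := hz
        _ = K * π / 𝓛 ^ 9 := by rw [hαeq]; ring
    have h := Lemma58.lemma_5_8_of_le χ hprim h𝓛 hA hKL hz'
    rw [add_sub_cancel_left] at h
    exact h
  have hρA : (ρ : ℂ) + βa = 1 + A := by rw [hAdef]; push_cast; ring
  have hρB : (ρ : ℂ) + βb = 1 + B := by rw [hBdef]; push_cast; ring
  have ha : ‖χ.LFunction ((ρ : ℂ) + βa) - ℓ * A‖ ≤ E := by rw [hρA]; exact h58 _ hAK
  have hb : ‖χ.LFunction ((ρ : ℂ) + βb) - ℓ * B‖ ≤ E := by rw [hρB]; exact h58 _ hBK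
  -- `L′(ρ̃) − L′(1)`
  have h0 : ‖deriv χ.LFunction ρ - ℓ‖ ≤ E' := by
    have hβ' : ‖(((1 - ρ : ℝ)) : ℂ)‖ ≤ 1 / (4 * Real.log D) := by
      rw [Complex.norm_real, Real.norm_eq_abs, abs_of_nonneg (by linarith)]; exact hρL
    have h := U055.norm_deriv_LFunction_sub_le χ h𝓛 hprim hβ'
    have e : (1 : ℂ) - (((1 - ρ : ℝ)) : ℂ) = (ρ : ℂ) := by push_cast; ring
    rw [e, Complex.norm_real, Real.norm_eq_abs, abs_of_nonneg (by linarith : (0 : ℝ) ≤ 1 - ρ)] at h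
    rw [hE'def]
    exact h
  -- Lemma 8.3 (iii′) at `ρ̃`
  have hu : ‖U ρ - PiW χ d r‖ ≤ C₈₃ * (ell D ^ 8)⁻¹ * hatPi :=
    hU3 _ (by
      have : (ρ : ℂ) - 1 = ((ρ - 1 : ℝ) : ℂ) := by push_cast; ring
      rw [this, hκn]; linarith)
  have hE0 : 0 ≤ E := by positivity
  have hhat0 : 0 ≤ hatPi := Finset.prod_nonneg fun q hq => by
    have hq2 : (2 : ℝ) ≤ q := by exact_mod_cast (Nat.prime_of_mem_primeFactors hq).two_le
    have : (q : ℝ)⁻¹ ≤ 1 / 2 := by rw [inv_eq_one_div]; gcongr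
    exact inv_nonneg.2 (by linarith)
  have hEU0 : 0 ≤ C₈₃ * (ell D ^ 8)⁻¹ * hatPi := by positivity
  have hE'0 : 0 ≤ E' := by
    rw [hE'def]
    have h1 : 0 ≤ 1 - ρ := by linarith
    have h2 : 0 ≤ 8 * Real.exp (9 / 2) * (1 + 𝓛) * 𝓛 ^ 2 := by positivity
    exact mul_nonneg h2 h1
  have hE'ℓ : E' ≤ ℓ₀ / 2 := hρE
  -- the coefficient algebra
  have hcoef := norm_coeff_sub_model_le (u := U ρ) (La := χ.LFunction ((ρ : ℂ) + βa))
    (Lb := χ.LFunction ((ρ : ℂ) + βb)) (L0 := deriv χ.LFunction ρ) (Pv := PiW χ d r) (ℓ := ℓ)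
    (A := A) (B := B) (a := βa) (b := βb) hα0 hK1 hℓ₀ hℓ hE0 hEU0 hE'0 (by linarith) hE hE'ℓ
    ha hb h0 hu hAK hBK haK hbK hAa hBb
  -- the kernel
  have hker := norm_kernel_le (Y := Y) (Λ := Λ) (s := s) hα0 hκ0 hκ hs_lo hs1 hsre hY hαY hΛ
  have hkerd := norm_kernel_sub_le (Y := Y) (Λ := Λ) (s := s) hα0 hκ0 hκ hs_lo hs1 hsre hY hαY
    (by rw [habsκ]; exact hρY) hΛ
  have eκ : (((ρ - 1 : ℝ)) : ℂ) = ((ρ - 1 : ℝ) : ℂ) := rfl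
  -- combine: `rK − Πℓab·K₀ = (r − Πℓab)K + Πℓab(K − K₀)`
  set Kτ : ℂ := (Y : ℂ) ^ (((ρ - 1 : ℝ) : ℂ) - s) * omega1 Λ (((ρ - 1 : ℝ) : ℂ) - s) /
    (((ρ - 1 : ℝ) : ℂ) - s) with hKτ
  set K₀ : ℂ := (Y : ℂ) ^ (-s) / (-s) with hK₀
  set rr : ℂ := U ρ * χ.LFunction ((ρ : ℂ) + βa) * χ.LFunction ((ρ : ℂ) + βb) /
    deriv χ.LFunction ρ with hrr
  have hsplit : rr * Kτ - ℓ * PiW χ d r * (βa * βb * K₀) =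
      (rr - PiW χ d r * ℓ * βa * βb) * Kτ + PiW χ d r * ℓ * βa * βb * (Kτ - K₀) := by ring
  rw [hsplit]
  have hPi : ‖PiW χ d r‖ ≤ hatPi ^ 2 := norm_PiW_le_prodInv χ hd hr
  have hℓle : ‖ℓ‖ ≤ ℓ₁ :=
    Lemma31.norm_deriv_LFunction_le_near_one χ h𝓛 hprim (w := 1)
      (by rw [sub_self, norm_zero]; positivity)
  have h1 : ‖(rr - PiW χ d r * ℓ * βa * βb) * Kτ‖ ≤
      (8 * (C₈₃ * (ell D ^ 8)⁻¹ * hatPi) * ℓ₁ * K ^ 2 * α ^ 2 + 6 * hatPi ^ 2 * K * α * E +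
        2 * hatPi ^ 2 * K ^ 2 * α ^ 2 * E' + 4 * hatPi ^ 2 * ℓ₁ * K * α * (1 - ρ)) *
        (8 * Real.exp π / α) := by
    rw [norm_mul]
    refine mul_le_mul (hcoef.trans ?_) hker (norm_nonneg _) (by positivity)
    have : 0 ≤ 1 - ρ := by linarith
    gcongr
  have h2 : ‖PiW χ d r * ℓ * βa * βb * (Kτ - K₀)‖ ≤
      hatPi ^ 2 * ℓ₁ * (K * α) * (K * α) *
        (Real.exp π * ((2 * Real.exp 1 * |ρ - 1| * Real.log Y + 1 / (2 * Λ)) * (4 / α) +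
          |ρ - 1| * (8 / α ^ 2))) := by
    rw [norm_mul, norm_mul, norm_mul, norm_mul]
    gcongr
  calc ‖(rr - PiW χ d r * ℓ * βa * βb) * Kτ + PiW χ d r * ℓ * βa * βb * (Kτ - K₀)‖
      ≤ ‖(rr - PiW χ d r * ℓ * βa * βb) * Kτ‖ + ‖PiW χ d r * ℓ * βa * βb * (Kτ - K₀)‖ :=
        norm_add_le _ _
    _ ≤ _ := add_le_add h1 h2
    _ = _ := by ring

end ResidueTwo

end Literature.NumberTheory.LFunctions.Zhang2022.Lemma84
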